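import Summits.Ventures.PercRepro.MergeModel
import Summits.Ventures.PercRepro.Concavity6
import Summits.Ventures.PercRepro.CrossTermPlus

/-!
# Merge types along an edge: the graph side of `TypeIdentity`

`TypeIdentity` (typer-2, `Lemma6.lean`) is the identity `Q⁺(Δ_g, Δ_g) = sixMarkLHS − sixMarkRHS` of
the C-011 dossier §1–§3.  Its combinatorial content is the classification of ONE configuration `ω`
by how opening the edge `g = uv` changes the marked partition of `a, b, c, d` — proved in
`MergeModel.lean` on a finite model (row pattern, attachment bits, consistency) by the kernel.
This file is the bridge: the bits of a configuration (`patOf`, `auOf`, `avOf`, `uvOf`) are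
consistent (`consistent_of`), the pattern after opening `g` is `after` (`patAfter_eq_after`, from
`conn_update_true_iff`), the type events of `Concavity6.lean` are the bit predicates
(`mem_typeA_iff` … `mem_typeE_iff`, `mem_typeEvent_iff`), the merge vector
`e_{row(ω[g:=1])} − e_{row(ω[g:=0])}` is the model's `mv` (`mergeVec_eq_mv`), vanishes without a
type (`mergeVec_eq_zero`) and is a variant of the type otherwise (`mergeVec_mem_variants`); hence
**`quadPlus_mergeVec`**: `Q⁺(mergeVec ω, mergeVec ω') = K(type ω, type ω') / 2` (the sign table
of §2), `0` if either configuration does not move the partition.  What remains for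
`TypeIdentity` is algebra: `Δ_g = Σ_ω w_{p∖g}(ω) · mergeVec ω`, bilinearity of `Q⁺`, and the
regrouping `Σ_{T,T'} (K T T' / 2) · P(T) P(T') = sixMarkLHS − sixMarkRHS`.
-/

namespace PercRepro

/-! ### The graph side: bits of a configuration -/

namespace MultiGraph

open Merge4

variable {V E : Type*} (G : MultiGraph V E) [DecidableEq E] (g : E) (a b c d : V)

open Classical in
/-- The connectivity pattern of the four marks in `G − g`. -/
noncomputable def patOf (ω : Config E) : Fin 4 → Fin 4 → Bool :=
  fun i j => decide (G.ConnWithout g ω (![a, b, c, d] i) (![a, b, c, d] j))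

open Classical in
/-- The marks attached to the endpoint `u = G.fst g` in `G − g`. -/
noncomputable def auOf (ω : Config E) : Fin 4 → Bool :=
  fun i => decide (G.ConnWithout g ω (G.fst g) (![a, b, c, d] i))

open Classical in
/-- The marks attached to the endpoint `v = G.snd g` in `G − g`. -/
noncomputable def avOf (ω : Config E) : Fin 4 → Bool :=
  fun i => decide (G.ConnWithout g ω (G.snd g) (![a, b, c, d] i))

open Classical in
/-- Whether the endpoints of `g` are already connected in `G − g`. -/
noncomputable def uvOf (ω : Config E) : Bool := decide (G.ConnWithout g ω (G.fst g) (G.snd g))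

/-- The row of the marked partition in `G − g`. -/
noncomputable def rowBefore (ω : Config E) : Fin 15 :=
  row4 (G.markedPartition (Function.update ω g false) ![a, b, c, d])

/-- The row of the marked partition with `g` open. -/
noncomputable def rowAfter (ω : Config E) : Fin 15 :=
  row4 (G.markedPartition (Function.update ω g true) ![a, b, c, d])

/-- The pattern of a configuration is the pattern of its row. -/
theorem patOf_eq_pat (ω : Config E) : G.patOf g a b c d ω = pat (G.rowBefore g a b c d ω) := by
  have h := (G.row4_markedPartition_eq_iff (ω := Function.update ω g false) ![a, b, c, d]
    (G.rowBefore g a b c d ω)).1 rfl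
  funext i j
  simp only [patOf, pat, ConnWithout]
  exact decide_eq_decide.2 (h i j)

/-- The pattern after opening `g` is `after` of the pattern and attachments before. -/
theorem patAfter_eq_after (ω : Config E) :
    pat (G.rowAfter g a b c d ω) = after (G.patOf g a b c d ω) (G.auOf g a b c d ω) (G.avOf g a b c d ω) := by
  have h := (G.row4_markedPartition_eq_iff (ω := Function.update ω g true) ![a, b, c, d]
    (G.rowAfter g a b c d ω)).1 rfl
  funext i j
  have key : G.Conn (Function.update ω g true) (![a, b, c, d] i) (![a, b, c, d] j) ↔
      G.ConnWithout g ω (![a, b, c, d] i) (![a, b, c, d] j) ∨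
        (G.ConnWithout g ω (G.fst g) (![a, b, c, d] i) ∧
          G.ConnWithout g ω (G.snd g) (![a, b, c, d] j)) ∨
        (G.ConnWithout g ω (G.snd g) (![a, b, c, d] i) ∧
          G.ConnWithout g ω (G.fst g) (![a, b, c, d] j)) := by
    have e : Function.update ω g true = Function.update (Function.update ω g false) g true := by
      simp
    rw [e, G.conn_update_true_iff]
    simp only [ConnWithout]
    constructor
    · rintro (h | ⟨h1, h2⟩ | ⟨h1, h2⟩)
      · exact Or.inl h
      · exact Or.inr (Or.inl ⟨h1.symm, h2⟩)
      · exact Or.inr (Or.inr ⟨h1.symm, h2⟩)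
    · rintro (h | ⟨h1, h2⟩ | ⟨h1, h2⟩)
      · exact Or.inl h
      · exact Or.inr (Or.inl ⟨h1.symm, h2⟩)
      · exact Or.inr (Or.inr ⟨h1.symm, h2⟩)
  simp only [pat, after, patOf, auOf, avOf]
  rw [Bool.eq_iff_iff]
  simp only [decide_eq_true_iff, Bool.or_eq_true, Bool.and_eq_true]
  exact (h i j).symm.trans (key.trans or_assoc.symm)

/-- The bits of a configuration are consistent. -/
theorem consistent_of (ω : Config E) :
    Consistent (G.patOf g a b c d ω) (G.auOf g a b c d ω) (G.avOf g a b c d ω)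
      (G.uvOf g ω) := by
  simp only [Consistent, patOf, auOf, avOf, uvOf, decide_eq_true_iff]
  refine ⟨fun i j h1 h2 => h1.trans h2, fun i j h1 h2 => h1.trans h2,
    fun i j h1 h2 => h1.symm.trans h2, fun i j h1 h2 => h1.symm.trans h2,
    fun huv i => ?_, fun i h1 h2 => h1.trans h2.symm⟩
  exact decide_eq_decide.2 ⟨fun h => huv.symm.trans h, fun h => huv.trans h⟩

/-- The merge vector of `ω` along `g`: `e_{row after} − e_{row before}`, as reals. -/
noncomputable def mergeVec (ω : Config E) : Fin 15 → ℝ :=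
  fun s => (if G.rowAfter g a b c d ω = s then 1 else 0) -
    (if G.rowBefore g a b c d ω = s then 1 else 0)

/-- The merge vector is the model's `mv` at the row and attachments of `ω`. -/
theorem mergeVec_eq_mv (ω : Config E) :
    G.mergeVec g a b c d ω =
      fun s => ((mv (G.rowBefore g a b c d ω) (G.auOf g a b c d ω) (G.avOf g a b c d ω) s : ℤ) : ℝ) := by
  funext s
  simp only [mergeVec, mv]
  rw [← patOf_eq_pat, ← patAfter_eq_after, rowOf_pat]
  simp only [Int.cast_sub]
  split_ifs <;> simp_all

/-! ### The type events are the bit predicates -/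

/-- Type `Aᵢ` as bits. -/
theorem mem_typeA_iff (ω : Config E) (i : Fin 3) :
    ω ∈ G.typeA g a b c d i ↔
      typeAB (G.patOf g a b c d ω) (G.auOf g a b c d ω) (G.avOf g a b c d ω) i = true := by
  fin_cases i <;>
    simp [typeA, sepAllFour, linksPair, crossBlocks, typeAB, sepAllB, linksB, blk, patOf, auOf,
      avOf, and_assoc, or_assoc]

/-- Type `Bᵢ` as bits. -/
theorem mem_typeB_iff (ω : Config E) (i : Fin 3) :
    ω ∈ G.typeB g a b c d i ↔
      typeBB (G.patOf g a b c d ω) (G.auOf g a b c d ω) (G.avOf g a b c d ω) i = true := by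
  fin_cases i <;>
    simp [typeB, isRank1Cell, linksPair, crossBlocks, typeBB, rank1B, linksB, blk, patOf, auOf,
      avOf, and_assoc]

/-- Type `Cᵢ` as bits. -/
theorem mem_typeC_iff (ω : Config E) (i : Fin 3) :
    ω ∈ G.typeC g a b c d i ↔
      typeCB (G.patOf g a b c d ω) (G.auOf g a b c d ω) (G.avOf g a b c d ω) i = true := by
  fin_cases i <;>
    simp [typeC, isRank1Cell, linksPair, crossBlocks, typeCB, rank1B, linksB, blk, patOf, auOf,
      avOf, and_assoc, or_assoc]

/-- Type `Dᵢ` as bits. -/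
theorem mem_typeD_iff (ω : Config E) (i : Fin 3) :
    ω ∈ G.typeD g a b c d i ↔
      typeDB (G.patOf g a b c d ω) (G.auOf g a b c d ω) (G.avOf g a b c d ω) i = true := by
  fin_cases i <;>
    simp [typeD, isCrossCell, linksPair, crossBlocks, typeDB, crossB, linksB, blk, patOf, auOf,
      avOf, and_assoc]

/-- Type `E` as bits. -/
theorem mem_typeE_iff (ω : Config E) :
    ω ∈ G.typeE g a b c d ↔
      typeEB (G.patOf g a b c d ω) (G.auOf g a b c d ω) (G.avOf g a b c d ω) = true := by
  simp [typeE, isThreeOneCell, linksPair, typeEB, threeOneB, linksB, patOf, auOf, avOf,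
    and_assoc, or_assoc]

/-! ### The interface: type events, merge vectors and `Q⁺` on pairs -/

/-- The type event of a merge type. -/
def typeEvent : MType → Set (Config E)
  | .A i => G.typeA g a b c d i
  | .B i => G.typeB g a b c d i
  | .C i => G.typeC g a b c d i
  | .D i => G.typeD g a b c d i
  | .E => G.typeE g a b c d

/-- The type of a configuration: `typeOf` on its bits. -/
noncomputable def typeOfConfig (ω : Config E) : Option MType :=
  typeOf (G.patOf g a b c d ω) (G.auOf g a b c d ω) (G.avOf g a b c d ω)

/-- **Membership in a type event is the type**: `ω ∈ typeEvent T ↔ typeOfConfig ω = some T`. -/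
theorem mem_typeEvent_iff (ω : Config E) (T : MType) :
    ω ∈ G.typeEvent g a b c d T ↔ G.typeOfConfig g a b c d ω = some T := by
  have hc := G.consistent_of g a b c d ω
  rw [patOf_eq_pat] at hc
  have hx := types_exclusive _ _ _ _ hc
  rw [← patOf_eq_pat] at hx
  unfold typeOfConfig
  cases T with
  | A i => exact (G.mem_typeA_iff g a b c d ω i).trans (hx.1 i)
  | B i => exact (G.mem_typeB_iff g a b c d ω i).trans (hx.2.1 i)
  | C i => exact (G.mem_typeC_iff g a b c d ω i).trans (hx.2.2.1 i)
  | D i => exact (G.mem_typeD_iff g a b c d ω i).trans (hx.2.2.2.1 i)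
  | E => exact (G.mem_typeE_iff g a b c d ω).trans hx.2.2.2.2

/-- A configuration without a type does not move the marked partition: merge vector `0`. -/
theorem mergeVec_eq_zero (ω : Config E) (h : G.typeOfConfig g a b c d ω = none) :
    G.mergeVec g a b c d ω = fun _ => 0 := by
  have hc := G.consistent_of g a b c d ω
  rw [patOf_eq_pat] at hc
  have hcl := (classify _ _ _ _ hc).1
  rw [← patOf_eq_pat] at hcl
  rw [mergeVec_eq_mv, hcl h]
  simp

/-- The merge vector of a typed configuration is one of the variants of its type. -/
theorem mergeVec_mem_variants (ω : Config E) (T : MType)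
    (h : G.typeOfConfig g a b c d ω = some T) :
    ∃ v ∈ variants T, G.mergeVec g a b c d ω = fun s => ((v s : ℤ) : ℝ) := by
  have hc := G.consistent_of g a b c d ω
  rw [patOf_eq_pat] at hc
  have hcl := (classify _ _ _ _ hc).2 T
  rw [← patOf_eq_pat] at hcl
  exact ⟨_, hcl h, G.mergeVec_eq_mv g a b c d ω⟩

end MultiGraph

namespace Merge4

/-- `Q⁺` on integer vectors is `quad2 / 2`. -/
theorem quadPlus_cast (u v : Fin 15 → ℤ) :
    quadPlus (fun s => ((u s : ℤ) : ℝ)) (fun s => ((v s : ℤ) : ℝ)) = ((quad2 u v : ℤ) : ℝ) / 2 := by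
  simp only [quadPlus, quad2, crossOf, rank1Of, crossZ, rank1Z, Fin.sum_univ_three]
  simp [Matrix.cons_val]
  ring

end Merge4

namespace MultiGraph

open Merge4

variable {V E : Type*} (G : MultiGraph V E) [DecidableEq E] (g : E) (a b c d : V)

/-- **`Q⁺` on the merge vectors of two configurations is the sign table of their types**
(`K / 2`), and `0` if either configuration does not move the marked partition. -/
theorem quadPlus_mergeVec (ω ω' : Config E) :
    quadPlus (G.mergeVec g a b c d ω) (G.mergeVec g a b c d ω') =
      match G.typeOfConfig g a b c d ω, G.typeOfConfig g a b c d ω' with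
      | some T, some T' => ((K T T' : ℤ) : ℝ) / 2
      | _, _ => 0 := by
  rcases hT : G.typeOfConfig g a b c d ω with _ | T
  · rw [G.mergeVec_eq_zero g a b c d ω hT]
    simp [quadPlus, crossOf, rank1Of, Fin.sum_univ_three]
  rcases hT' : G.typeOfConfig g a b c d ω' with _ | T'
  · rw [G.mergeVec_eq_zero g a b c d ω' hT']
    simp [quadPlus, crossOf, rank1Of, Fin.sum_univ_three]
  obtain ⟨v, hv, hv'⟩ := G.mergeVec_mem_variants g a b c d ω T hT
  obtain ⟨w, hw, hw'⟩ := G.mergeVec_mem_variants g a b c d ω' T' hT'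
  rw [hv', hw', quadPlus_cast, quad2_variants T (mem_allTypes T) T' (mem_allTypes T') v hv w hw]

end MultiGraph

end PercRepro
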